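import Literature.NumberTheory.Automorphic.GL2CCoeffRepSmooth
import Literature.NumberTheory.Automorphic.GL2CEquivariantPrimitiveGrowth
import HarnessLib

/-!
# Polynomial growth of the coefficient representation `E_λ(ℂ)` on `GL₂(ℂ)`

For `K` totally complex with one infinite place and a weight family `λ`, the action
`E(M) = coeffRepC K λ (toGL M)` of `GL₂(ℂ)` on `E_λ(ℂ) = ⊗_τ V_{λ_τ}` (`GL2CCoeffRepComplex`) has
**polynomial growth in the size `s(M) = 1 + ‖M‖ + ‖M⁻¹‖`** of `GL2CEquivariantPrimitiveGrowth`: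

  `‖E(M) v‖ ≤ C s(M)^k ‖v‖`  and  `‖E(M)⁻¹ v‖ ≤ C s(M)^k ‖v‖`  (`exists_norm_coeffRepC_le`,
  `exists_norm_coeffRepC_inv_le`),

because every matrix coefficient is `det(M̃_τ)^{λ_{τ,1}}` times a polynomial in the entries of
`M` or `M̄` (`isPolynomialRep_weylRep_holds`, as in `GL2CCoeffRepSmooth`), `|M_{ij}| ≤ s(M)` and
`|det M|^{±1} ≤ 2 s(M)²`.  The book-keeping is the predicate `PolyGrowth` (closed under sums and
products).  This is the coefficient-side input of the moderate growth of the primitive of the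
Eichler–Shimura–Harder cochain (`GL2CESHPrimitiveFunction`). [cite: BorelWallach2000, VII §2.2 and XIV 2.3]
[cite: FultonHarrisGTM129, §15.5]

Theorems and one Prop-valued predicate (`PolyGrowth`, with body); no named fact.
-/

noncomputable section

open scoped Matrix ComplexConjugate MatrixGroups Matrix.Norms.Operator BigOperators
open Complex Finset Matrix

namespace Literature.NumberTheory.Automorphic

namespace GL2CCoeff

open scoped Classical
open _root_.NumberField _root_.NumberField.InfinitePlace _root_.NumberField.mixedEmbedding
open RealMatrixGroup GLnCohomology ResGLnCohomology ComplexPlace ImaginaryQuadratic GL2C GL2CKType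
open Literature.NumberTheory.DiophantineGeometry

/-! ### Functions of polynomial growth in `s(M)` -/

/-- `h` has polynomial growth on `Inv`: `‖h M‖ ≤ C s(M)^k`, `s(M) = 1 + ‖M‖ + ‖M⁻¹‖`. [folklore] -/
def PolyGrowth {F : Type*} [Norm F] (h : Mat → F) : Prop :=
  ∃ (C : ℝ) (k : ℕ), 0 ≤ C ∧ ∀ M ∈ GL2C.Inv, ‖h M‖ ≤ C * (1 + ‖M‖ + ‖M⁻¹‖) ^ k

namespace PolyGrowth

section Additive

variable {F : Type*} [SeminormedAddCommGroup F]

/-- Raising the exponent. [folklore] -/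
theorem mono_exp {h : Mat → F} {C : ℝ} {k k' : ℕ} (hC : 0 ≤ C) (hk : k ≤ k')
    (H : ∀ M ∈ GL2C.Inv, ‖h M‖ ≤ C * (1 + ‖M‖ + ‖M⁻¹‖) ^ k) :
    ∀ M ∈ GL2C.Inv, ‖h M‖ ≤ C * (1 + ‖M‖ + ‖M⁻¹‖) ^ k' := fun M hM =>
  (H M hM).trans (mul_le_mul_of_nonneg_left (pow_le_pow_right₀ (one_le_size M) hk) hC)

/-- Constants. [folklore] -/
theorem const (c : F) : PolyGrowth fun _ : Mat => c :=
  ⟨‖c‖, 0, norm_nonneg _, fun M _ => by rw [pow_zero, mul_one]⟩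

/-- Sums. [folklore] -/
theorem add {h₁ h₂ : Mat → F} (H₁ : PolyGrowth h₁) (H₂ : PolyGrowth h₂) : PolyGrowth fun M => h₁ M + h₂ M := by
  obtain ⟨C₁, k₁, hC₁, H₁⟩ := H₁
  obtain ⟨C₂, k₂, hC₂, H₂⟩ := H₂
  refine ⟨C₁ + C₂, max k₁ k₂, add_nonneg hC₁ hC₂, fun M hM => ?_⟩
  have h1 := mono_exp hC₁ (le_max_left k₁ k₂) H₁ M hM
  have h2 := mono_exp hC₂ (le_max_right k₁ k₂) H₂ M hM
  calc ‖h₁ M + h₂ M‖ ≤ ‖h₁ M‖ + ‖h₂ M‖ := norm_add_le _ _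
    _ ≤ _ := by rw [add_mul]; exact add_le_add h1 h2

/-- Finite sums. [folklore] -/
theorem sum {ι : Type*} (s : Finset ι) {h : ι → Mat → F} (H : ∀ i ∈ s, PolyGrowth (h i)) :
    PolyGrowth fun M => ∑ i ∈ s, h i M := by
  induction s using Finset.induction_on with
  | empty => simpa using const (0 : F)
  | insert a s ha ih =>
    have := (H a (mem_insert_self a s)).add (ih fun i hi => H i (mem_insert_of_mem hi))
    simpa [Finset.sum_insert ha] using this

end Additive

section Multiplicative

variable {F : Type*} [NormedRing F]

/-- Products. [folklore] -/
theorem mul {h₁ h₂ : Mat → F} (H₁ : PolyGrowth h₁) (H₂ : PolyGrowth h₂) : PolyGrowth fun M => h₁ M * h₂ M := by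
  obtain ⟨C₁, k₁, hC₁, H₁⟩ := H₁
  obtain ⟨C₂, k₂, hC₂, H₂⟩ := H₂
  refine ⟨C₁ * C₂, k₁ + k₂, mul_nonneg hC₁ hC₂, fun M hM => ?_⟩
  have hs := one_le_size M
  calc ‖h₁ M * h₂ M‖ ≤ ‖h₁ M‖ * ‖h₂ M‖ := norm_mul_le _ _
    _ ≤ (C₁ * (1 + ‖M‖ + ‖M⁻¹‖) ^ k₁) * (C₂ * (1 + ‖M‖ + ‖M⁻¹‖) ^ k₂) :=
        mul_le_mul (H₁ M hM) (H₂ M hM) (norm_nonneg _) (mul_nonneg hC₁ (pow_nonneg (by positivity) _))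
    _ = C₁ * C₂ * (1 + ‖M‖ + ‖M⁻¹‖) ^ (k₁ + k₂) := by rw [pow_add]; ring

/-- Finite products. [folklore] -/
theorem prod {ι : Type*} (s : Finset ι) {F' : Type*} [NormedCommRing F'] [NormOneClass F'] {h : ι → Mat → F'}
    (H : ∀ i ∈ s, PolyGrowth (h i)) : PolyGrowth fun M => ∏ i ∈ s, h i M := by
  induction s using Finset.induction_on with
  | empty => simpa using const (1 : F')
  | insert a s ha ih =>
    have := (H a (mem_insert_self a s)).mul (ih fun i hi => H i (mem_insert_of_mem hi))
    simpa [Finset.prod_insert ha] using this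

end Multiplicative

/-- Domination. [folklore] -/
theorem of_norm_le {F F' : Type*} [Norm F] [Norm F'] {h : Mat → F} {h' : Mat → F'} (H : PolyGrowth h)
    (hle : ∀ M ∈ GL2C.Inv, ‖h' M‖ ≤ ‖h M‖) : PolyGrowth h' := by
  obtain ⟨C, k, hC, H⟩ := H
  exact ⟨C, k, hC, fun M hM => (hle M hM).trans (H M hM)⟩

end PolyGrowth

/-! ### Entries, conjugates, determinants -/

variable (K : Type) [Field K] [NumberField K] [IsTotallyComplex K]

/-- An entry of `M` or of `M̄` has polynomial growth. [folklore] -/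
theorem polyGrowth_factorMat_apply (τ : K →+* ℂ) (i j : Fin 2) : PolyGrowth fun M : Mat => factorMat K τ M i j := by
  refine ⟨1, 1, zero_le_one, fun M _ => ?_⟩
  rw [one_mul, pow_one]
  unfold factorMat
  split_ifs
  · exact norm_apply_le_size M i j
  · change ‖conj (M i j)‖ ≤ _
    rw [Complex.norm_conj]; exact norm_apply_le_size M i j

/-- A polynomial in the entries of `M` or `M̄` has polynomial growth. [folklore] -/
theorem polyGrowth_eval_factorMat (τ : K →+* ℂ) (P : MvPolynomial (Fin 2 × Fin 2) ℂ) :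
    PolyGrowth fun M : Mat => MvPolynomial.eval (fun ij : Fin 2 × Fin 2 => factorMat K τ M ij.1 ij.2) P := by
  induction P using MvPolynomial.induction_on with
  | C a => simpa only [MvPolynomial.eval_C] using PolyGrowth.const a
  | add p q hp hq => simpa only [map_add] using hp.add hq
  | mul_X p ij hp => simpa only [map_mul, MvPolynomial.eval_X] using hp.mul (polyGrowth_factorMat_apply K τ ij.1 ij.2)

/-- `|det M̃_τ|` and `|det M̃_τ|⁻¹` are `≤ 2 s(M)²` on `Inv`. [folklore] -/
theorem norm_det_factorMat_zpow_le (τ : K →+* ℂ) (z : ℤ) {M : Mat} (hM : M ∈ GL2C.Inv) :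
    ‖(factorMat K τ M).det ^ z‖ ≤ (2 * (1 + ‖M‖ + ‖M⁻¹‖) ^ 2) ^ z.natAbs := by
  have hdet : ∀ N : Mat, ‖(factorMat K τ N).det‖ = ‖N.det‖ := fun N => by
    unfold factorMat
    split_ifs
    · rfl
    · rw [show N.map conj = (starRingEnd ℂ).mapMatrix N from rfl, ← RingHom.map_det, Complex.norm_conj]
  have hs := one_le_size M
  rw [norm_zpow]
  rcases Int.natAbs_eq z with hz | hz
  · rw [hz, Int.natAbs_natCast, zpow_natCast, hdet]
    exact pow_le_pow_left₀ (norm_nonneg _) (norm_det_le_size M) _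
  · rw [hz, Int.natAbs_neg, Int.natAbs_natCast, _root_.zpow_neg, zpow_natCast, ← inv_pow, hdet]
    refine pow_le_pow_left₀ (inv_nonneg.2 (norm_nonneg _)) ?_ _
    -- `|det M|⁻¹ = |det M⁻¹| ≤ 2 s(M⁻¹)² = 2 s(M)²`
    have hu : IsUnit M.det := hM
    rw [← norm_inv, ← Ring.inverse_eq_inv', ← Matrix.det_nonsing_inv]
    have h := norm_det_le_size M⁻¹
    rwa [Matrix.nonsing_inv_nonsing_inv M hu, show 1 + ‖M⁻¹‖ + ‖M‖ = 1 + ‖M‖ + ‖M⁻¹‖ by ring] at h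

/-- `det(M̃_τ)^z` has polynomial growth. [folklore] -/
theorem polyGrowth_det_factorMat_zpow (τ : K →+* ℂ) (z : ℤ) : PolyGrowth fun M : Mat => (factorMat K τ M).det ^ z := by
  refine ⟨2 ^ z.natAbs, 2 * z.natAbs, by positivity, fun M hM => (norm_det_factorMat_zpow_le K τ z hM).trans_eq ?_⟩
  rw [mul_pow, ← pow_mul]

/-! ### Matrix coefficients of `E_λ(ℂ)` -/

variable (lam : (K →+* ℂ) → Fin 2 → ℤ)

/-- **Per factor: `M ↦ φ(V_{λ_τ}(M̃_τ) v)` has polynomial growth.** [cite: FultonHarrisGTM129, §15.5] -/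
theorem polyGrowth_factorRep_dual (hK : Subsingleton (InfinitePlace K)) (τ : K →+* ℂ)
    (v : GLnCohomology.CoeffModule ℂ 2 (lam τ)) (φ : Module.Dual ℂ (GLnCohomology.CoeffModule ℂ 2 (lam τ))) :
    PolyGrowth fun M : Mat => φ (ParallelWeight.factorRep K 2 (lam τ) τ (embGL K (toGL M)) v) := by
  obtain ⟨P, hP⟩ := isPolynomialRep_weylRep_holds ℂ (Fin 2) (coeffPartition (lam τ)) v φ
  have hformula : ∀ M ∈ GL2C.Inv, φ (ParallelWeight.factorRep K 2 (lam τ) τ (embGL K (toGL M)) v) =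
      (factorMat K τ M).det ^ lowestEntry (lam τ) *
        MvPolynomial.eval (fun ij : Fin 2 × Fin 2 => factorMat K τ M ij.1 ij.2) P := by
    intro M hM
    have hg := coe_map_embGL_toGL K hK τ (M := M) hM
    rw [ParallelWeight.factorRep_apply, coeffRepGL_apply, map_smul, smul_eq_mul]
    congr 1
    · rw [Units.val_zpow_eq_zpow_val, Matrix.GeneralLinearGroup.val_det_apply, hg]
    · have := hP (Matrix.GeneralLinearGroup.map (embeddingExt τ : mixedSpace K →+* ℂ)
        ((embGL K (toGL M) : (archGroupGL 2 K).carrier) : GL (Fin 2) (mixedSpace K)))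
      rw [hg] at this
      exact this
  refine ((polyGrowth_det_factorMat_zpow K τ (lowestEntry (lam τ))).mul (polyGrowth_eval_factorMat K τ P)).of_norm_le
    fun M hM => ?_
  rw [hformula M hM]

/-- **`M ↦ ℓ(E(M) v)` has polynomial growth** for every `v ∈ E_λ(ℂ)` and functional `ℓ`.
[cite: FultonHarrisGTM129, §15.5] [cite: BorelWallach2000, VII §2.2] -/
theorem polyGrowth_coeffRepC_dual (hK : Subsingleton (InfinitePlace K)) (v : ResGLnCohomology.CoeffModule ℂ 2 K lam)
    (ℓ : Module.Dual ℂ (ResGLnCohomology.CoeffModule ℂ 2 K lam)) :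
    PolyGrowth fun M : Mat => ℓ (coeffRepC K lam (toGL M) v) := by
  haveI : ∀ τ : K →+* ℂ, FiniteDimensional ℂ (GLnCohomology.CoeffModule ℂ 2 (lam τ)) := fun τ =>
    ParallelWeight.finiteDimensional_coeffModule 2 (lam τ)
  induction v using ResGLnCohomology.CoeffModule.induction_on generalizing ℓ with
  | smul_tprod c w =>
    simp only [map_smul, smul_eq_mul]
    refine (PolyGrowth.const c).mul ?_
    let b := fun τ : K →+* ℂ => Module.finBasis ℂ (GLnCohomology.CoeffModule ℂ 2 (lam τ))
    have hexp : ∀ M : Mat, ℓ (coeffRepC K lam (toGL M) (CoeffModule.tprod w)) =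
        ∑ J : (∀ τ : K →+* ℂ, Fin (Module.finrank ℂ (GLnCohomology.CoeffModule ℂ 2 (lam τ)))),
          (∏ τ, (b τ).coord (J τ) (ParallelWeight.factorRep K 2 (lam τ) τ (embGL K (toGL M)) (w τ))) *
            ℓ (CoeffModule.tprod fun τ => b τ (J τ)) := by
      intro M
      rw [coeffRepC_apply, ResGLnCohomology.archCoeffRep_apply_tprod]
      have hw : (fun τ => ParallelWeight.factorRep K 2 (lam τ) τ (embGL K (toGL M)) (w τ)) =
          fun τ => ∑ j, ((b τ).coord j (ParallelWeight.factorRep K 2 (lam τ) τ (embGL K (toGL M)) (w τ))) • b τ j :=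
        funext fun τ => ((b τ).sum_repr _).symm
      rw [hw]
      change ℓ (PiTensorProduct.tprod ℂ fun τ => ∑ j,
        ((b τ).coord j (ParallelWeight.factorRep K 2 (lam τ) τ (embGL K (toGL M)) (w τ))) • b τ j) = _
      rw [MultilinearMap.map_sum (PiTensorProduct.tprod ℂ)
        (fun τ j => ((b τ).coord j (ParallelWeight.factorRep K 2 (lam τ) τ (embGL K (toGL M)) (w τ))) • b τ j)]
      change ℓ (∑ r : (∀ τ : K →+* ℂ, Fin (Module.finrank ℂ (GLnCohomology.CoeffModule ℂ 2 (lam τ)))),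
        (CoeffModule.tprod fun i => ((b i).coord (r i)
          (ParallelWeight.factorRep K 2 (lam i) i (embGL K (toGL M)) (w i))) • b i (r i) :
          ResGLnCohomology.CoeffModule ℂ 2 K lam)) = _
      rw [map_sum ℓ]
      refine Finset.sum_congr rfl fun J _ => ?_
      change ℓ (PiTensorProduct.tprod ℂ fun i => ((b i).coord (J i)
          (ParallelWeight.factorRep K 2 (lam i) i (embGL K (toGL M)) (w i))) • b i (J i)) = _
      rw [MultilinearMap.map_smul_univ]
      change ℓ ((∏ i, (b i).coord (J i) (ParallelWeight.factorRep K 2 (lam i) i (embGL K (toGL M)) (w i))) •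
        (CoeffModule.tprod (fun i => b i (J i)) : ResGLnCohomology.CoeffModule ℂ 2 K lam)) = _
      rw [map_smul, smul_eq_mul]
    refine PolyGrowth.of_norm_le ?_ fun M _ => (congrArg norm (hexp M)).le
    refine PolyGrowth.sum _ fun J _ => PolyGrowth.mul ?_ (PolyGrowth.const _)
    exact PolyGrowth.prod _ fun τ _ => polyGrowth_factorRep_dual K lam hK τ (w τ) ((b τ).coord (J τ))
  | add x y hx hy =>
    simp only [map_add]
    exact (hx ℓ).add (hy ℓ)

/-! ### The norm of `E(M) v` -/

omit [IsTotallyComplex K] in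
/-- The norm of `E_λ(ℂ)` is the sup of the coordinates in `Module.finBasis`. [folklore] -/
theorem norm_eq_sup_coord (v : ResGLnCohomology.CoeffModule ℂ 2 K lam) :
    ‖v‖ = ‖(Module.finBasis ℂ (ResGLnCohomology.CoeffModule ℂ 2 K lam)).equivFun v‖ := rfl

omit [IsTotallyComplex K] in
/-- Each coordinate is bounded by the norm. [folklore] -/
theorem norm_coord_le (v : ResGLnCohomology.CoeffModule ℂ 2 K lam)
    (i : Fin (Module.finrank ℂ (ResGLnCohomology.CoeffModule ℂ 2 K lam))) :
    ‖(Module.finBasis ℂ (ResGLnCohomology.CoeffModule ℂ 2 K lam)).coord i v‖ ≤ ‖v‖ := by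
  rw [norm_eq_sup_coord]
  exact norm_le_pi_norm ((Module.finBasis ℂ (ResGLnCohomology.CoeffModule ℂ 2 K lam)).equivFun v) i

omit [IsTotallyComplex K] in
/-- The norm is bounded by the sum of the coordinates. [folklore] -/
theorem norm_le_sum_coord (v : ResGLnCohomology.CoeffModule ℂ 2 K lam) :
    ‖v‖ ≤ ∑ i, ‖(Module.finBasis ℂ (ResGLnCohomology.CoeffModule ℂ 2 K lam)).coord i v‖ := by
  rw [norm_eq_sup_coord, pi_norm_le_iff_of_nonneg (Finset.sum_nonneg fun i _ => norm_nonneg _)]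
  intro i
  exact Finset.single_le_sum (f := fun j => ‖(Module.finBasis ℂ (ResGLnCohomology.CoeffModule ℂ 2 K lam)).coord j v‖)
    (fun _ _ => norm_nonneg _) (Finset.mem_univ i)

/-- **`M ↦ E(M) v` has polynomial growth** (vector-valued, through the norm). [cite: BorelWallach2000, VII §2.2] -/
theorem polyGrowth_norm_coeffRepC (hK : Subsingleton (InfinitePlace K)) (v : ResGLnCohomology.CoeffModule ℂ 2 K lam) :
    PolyGrowth fun M : Mat => ‖coeffRepC K lam (toGL M) v‖ := by
  have H' : PolyGrowth fun M : Mat => ∑ i, ‖(Module.finBasis ℂ (ResGLnCohomology.CoeffModule ℂ 2 K lam)).coord i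
      (coeffRepC K lam (toGL M) v)‖ :=
    PolyGrowth.sum Finset.univ fun i _ =>
      (polyGrowth_coeffRepC_dual K lam hK v ((Module.finBasis ℂ _).coord i)).of_norm_le fun M _ => by
        rw [Real.norm_eq_abs, abs_norm]
  refine H'.of_norm_le fun M _ => ?_
  rw [Real.norm_eq_abs, abs_norm, Real.norm_eq_abs, abs_of_nonneg (Finset.sum_nonneg fun i _ => norm_nonneg _)]
  exact norm_le_sum_coord K lam _

/-- **Uniform polynomial growth**: `‖E(M) v‖ ≤ C s(M)^k ‖v‖`. [cite: BorelWallach2000, VII §2.2] -/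
theorem exists_norm_coeffRepC_le (hK : Subsingleton (InfinitePlace K)) :
    ∃ (C : ℝ) (k : ℕ), 0 ≤ C ∧ ∀ M ∈ GL2C.Inv, ∀ v : ResGLnCohomology.CoeffModule ℂ 2 K lam,
      ‖coeffRepC K lam (toGL M) v‖ ≤ C * (1 + ‖M‖ + ‖M⁻¹‖) ^ k * ‖v‖ := by
  have H : PolyGrowth fun M : Mat => ∑ i, ‖coeffRepC K lam (toGL M) (Module.finBasis ℂ (ResGLnCohomology.CoeffModule ℂ 2 K lam) i)‖ :=
    PolyGrowth.sum Finset.univ fun i _ => polyGrowth_norm_coeffRepC K lam hK _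
  obtain ⟨C, k, hC, H⟩ := H
  refine ⟨C, k, hC, fun M hM v => ?_⟩
  have hv : v = ∑ i, (Module.finBasis ℂ (ResGLnCohomology.CoeffModule ℂ 2 K lam)).coord i v •
      Module.finBasis ℂ (ResGLnCohomology.CoeffModule ℂ 2 K lam) i := ((Module.finBasis ℂ _).sum_repr v).symm
  have hsum := H M hM
  rw [Real.norm_eq_abs, abs_of_nonneg (Finset.sum_nonneg fun i _ => norm_nonneg _)] at hsum
  calc ‖coeffRepC K lam (toGL M) v‖
      = ‖∑ i, (Module.finBasis ℂ (ResGLnCohomology.CoeffModule ℂ 2 K lam)).coord i v •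
          coeffRepC K lam (toGL M) (Module.finBasis ℂ (ResGLnCohomology.CoeffModule ℂ 2 K lam) i)‖ := by
        conv_lhs => rw [hv]
        rw [map_sum]; simp only [map_smul]
    _ ≤ ∑ i, ‖(Module.finBasis ℂ (ResGLnCohomology.CoeffModule ℂ 2 K lam)).coord i v‖ *
          ‖coeffRepC K lam (toGL M) (Module.finBasis ℂ (ResGLnCohomology.CoeffModule ℂ 2 K lam) i)‖ :=
        norm_sum_le_of_le _ fun i _ => by rw [_root_.norm_smul]
    _ ≤ ∑ i, ‖v‖ * ‖coeffRepC K lam (toGL M) (Module.finBasis ℂ (ResGLnCohomology.CoeffModule ℂ 2 K lam) i)‖ :=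
        Finset.sum_le_sum fun i _ => mul_le_mul_of_nonneg_right (norm_coord_le K lam v i) (norm_nonneg _)
    _ = ‖v‖ * ∑ i, ‖coeffRepC K lam (toGL M) (Module.finBasis ℂ (ResGLnCohomology.CoeffModule ℂ 2 K lam) i)‖ := by
        rw [Finset.mul_sum]
    _ ≤ ‖v‖ * (C * (1 + ‖M‖ + ‖M⁻¹‖) ^ k) := mul_le_mul_of_nonneg_left hsum (norm_nonneg _)
    _ = C * (1 + ‖M‖ + ‖M⁻¹‖) ^ k * ‖v‖ := by ring

/-- `toGL (M⁻¹) = (toGL M)⁻¹` for `M` invertible. [folklore] -/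
theorem toGL_nonsing_inv {M : Mat} (hM : M ∈ GL2C.Inv) : toGL M⁻¹ = (toGL M)⁻¹ := by
  have hu : IsUnit M.det := hM
  rw [show M⁻¹ = (((toGL M)⁻¹ : GL (Fin 2) ℂ) : Mat) by rw [Matrix.coe_units_inv, coe_toGL hM], toGL_coe]

/-- **Uniform polynomial growth of the inverse**: `‖E(M)⁻¹ v‖ ≤ C s(M)^k ‖v‖`. [cite: BorelWallach2000, VII §2.2] -/
theorem exists_norm_coeffRepC_inv_le (hK : Subsingleton (InfinitePlace K)) :
    ∃ (C : ℝ) (k : ℕ), 0 ≤ C ∧ ∀ M ∈ GL2C.Inv, ∀ v : ResGLnCohomology.CoeffModule ℂ 2 K lam,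
      ‖coeffRepC K lam (toGL M)⁻¹ v‖ ≤ C * (1 + ‖M‖ + ‖M⁻¹‖) ^ k * ‖v‖ := by
  obtain ⟨C, k, hC, H⟩ := exists_norm_coeffRepC_le K lam hK
  refine ⟨C, k, hC, fun M hM v => ?_⟩
  have hu : IsUnit M.det := hM
  have hM' : M⁻¹ ∈ GL2C.Inv := by
    change IsUnit M⁻¹.det
    rw [Matrix.det_nonsing_inv]; exact hu.ringInverse
  have h := H M⁻¹ hM' v
  rwa [toGL_nonsing_inv hM, Matrix.nonsing_inv_nonsing_inv M hu,
    show 1 + ‖M⁻¹‖ + ‖M‖ = 1 + ‖M‖ + ‖M⁻¹‖ by ring] at h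

end GL2CCoeff

end Literature.NumberTheory.Automorphic

end
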